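import Mathlib

/-!
# Increment convexity of the alternating block energy, IV: per-site curvature bounds

Helper for stub `stub_convexity` of line `Sketch` of crux `PeriodicGivenLayered`
(stmt-AtomisticToContinuum-11779). In the scaled variables `t = H²/a²`, `b = a⁻⁶ ∈ [1, 29/20]`,
`v = (P + t)⁻¹` (`P` the normalised in-plane form of the site), the second `H`-derivative of the
Lennard-Jones layer term is `a⁻⁸ [b v⁸ (13t - P) - v⁵ (7t - P)]`. This file bounds the bracket:
from below by `113/50` at the three nearest offset sites (`P = 1/3`, `t ∈ [0.78², 0.85²]`;
monotonicity in `t` via the sign of a derivative), and in absolute value by the explicit majorant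
`max(7T₂-P, P-7T₁)(P+T₁)⁻⁵ + (29/20) max(13T₂-P, P-13T₁)(P+T₁)⁻⁸` for `t ∈ [T₁, T₂]`, resp. by
`C (P+T₁)⁻⁴` with `C ≥ 7 + (29/20)·13·T₁⁻³`. [folklore]
-/

noncomputable section

namespace Summit.AtomisticToContinuum.Crystallization.Theorems.LayeredHull

/-! ## Far sites: the explicit majorant -/

/-- **Far-site bound.** For `0 ≤ P`, `0 < T₁ ≤ t ≤ T₂` and `0 ≤ b ≤ 29/20`,
`b v⁸(13t - P) - v⁵(7t - P) ≥ -[max(7T₂-P, P-7T₁)(P+T₁)⁻⁵ + (29/20) max(13T₂-P, P-13T₁)(P+T₁)⁻⁸]`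
(`v = (P+t)⁻¹`). [folklore] -/
theorem cvx_site_far (P T₁ T₂ t b : ℝ) (hP : 0 ≤ P) (hT : 0 < T₁) (ht1 : T₁ ≤ t)
    (ht2 : t ≤ T₂) (hb0 : 0 ≤ b) (hb : b ≤ 29 / 20) :
    -(max (7 * T₂ - P) (P - 7 * T₁) * ((P + T₁)⁻¹) ^ 5 +
        29 / 20 * max (13 * T₂ - P) (P - 13 * T₁) * ((P + T₁)⁻¹) ^ 8) ≤
      b * ((P + t)⁻¹) ^ 8 * (13 * t - P) - ((P + t)⁻¹) ^ 5 * (7 * t - P) := by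
  have ht0 : 0 < t := lt_of_lt_of_le hT ht1
  set v := (P + t)⁻¹ with hv
  set v₁ := (P + T₁)⁻¹ with hv₁
  set mA := max (7 * T₂ - P) (P - 7 * T₁) with hmA
  set mR := max (13 * T₂ - P) (P - 13 * T₁) with hmR
  have hv0 : 0 ≤ v := by rw [hv]; positivity
  have hvv : v ≤ v₁ := by rw [hv, hv₁]; exact inv_anti₀ (by positivity) (by linarith)
  have hA_abs : |7 * t - P| ≤ mA := by
    rw [abs_le]
    constructor
    · have : P - 7 * T₁ ≤ mA := le_max_right _ _
      linarith
    · have : 7 * T₂ - P ≤ mA := le_max_left _ _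
      linarith
  have hR_abs : |13 * t - P| ≤ mR := by
    rw [abs_le]
    constructor
    · have : P - 13 * T₁ ≤ mR := le_max_right _ _
      linarith
    · have : 13 * T₂ - P ≤ mR := le_max_left _ _
      linarith
  have hmA0 : 0 ≤ mA := (abs_nonneg _).trans hA_abs
  have hmR0 : 0 ≤ mR := (abs_nonneg _).trans hR_abs
  have h5 : v ^ 5 ≤ v₁ ^ 5 := pow_le_pow_left₀ hv0 hvv 5
  have h8 : v ^ 8 ≤ v₁ ^ 8 := pow_le_pow_left₀ hv0 hvv 8
  have hA : v ^ 5 * (7 * t - P) ≤ mA * v₁ ^ 5 := by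
    calc v ^ 5 * (7 * t - P) ≤ v ^ 5 * |7 * t - P| :=
          mul_le_mul_of_nonneg_left (le_abs_self _) (pow_nonneg hv0 5)
      _ ≤ v ^ 5 * mA := mul_le_mul_of_nonneg_left hA_abs (pow_nonneg hv0 5)
      _ ≤ v₁ ^ 5 * mA := mul_le_mul_of_nonneg_right h5 hmA0
      _ = mA * v₁ ^ 5 := mul_comm _ _
  have hR : -(29 / 20 * mR * v₁ ^ 8) ≤ b * v ^ 8 * (13 * t - P) := by
    have h1 : b * v ^ 8 * |13 * t - P| ≤ 29 / 20 * mR * v₁ ^ 8 := by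
      calc b * v ^ 8 * |13 * t - P| ≤ b * v ^ 8 * mR :=
            mul_le_mul_of_nonneg_left hR_abs (by positivity)
        _ ≤ 29 / 20 * v₁ ^ 8 * mR := by
            apply mul_le_mul_of_nonneg_right _ hmR0
            exact mul_le_mul hb h8 (pow_nonneg hv0 8) (by norm_num)
        _ = 29 / 20 * mR * v₁ ^ 8 := by ring
    have h2 : -(b * v ^ 8 * |13 * t - P|) ≤ b * v ^ 8 * (13 * t - P) := by
      have := neg_abs_le (13 * t - P)
      have hbv : 0 ≤ b * v ^ 8 := by positivity
      nlinarith
    linarith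
  linarith

/-- **Analytic-regime bound.** For `0 ≤ P`, `0 < T₁ ≤ t`, `0 ≤ b ≤ 29/20` and
`C ≥ 7 + (29/20)·13·T₁⁻³`: `b v⁸(13t - P) - v⁵(7t - P) ≥ -C (P+T₁)⁻⁴`. [folklore] -/
theorem cvx_site_analytic (P T₁ t b C : ℝ) (hP : 0 ≤ P) (hT : 0 < T₁) (ht1 : T₁ ≤ t)
    (hb0 : 0 ≤ b) (hb : b ≤ 29 / 20) (hC : 7 + 29 / 20 * 13 * (T₁⁻¹) ^ 3 ≤ C) :
    -(C * ((P + T₁)⁻¹) ^ 4) ≤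
      b * ((P + t)⁻¹) ^ 8 * (13 * t - P) - ((P + t)⁻¹) ^ 5 * (7 * t - P) := by
  have hq : 0 < P + t := by linarith
  set v := (P + t)⁻¹ with hv
  set v₁ := (P + T₁)⁻¹ with hv₁
  have hv0 : 0 < v := by rw [hv]; exact inv_pos.2 hq
  have hvq : v * (P + t) = 1 := by rw [hv]; exact inv_mul_cancel₀ hq.ne'
  have hvv : v ≤ v₁ := by rw [hv, hv₁]; exact inv_anti₀ (by positivity) (by linarith)
  have hvT : v ≤ T₁⁻¹ := by rw [hv]; exact inv_anti₀ hT (by linarith)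
  have h4 : v ^ 4 ≤ v₁ ^ 4 := pow_le_pow_left₀ hv0.le hvv 4
  have h3 : v ^ 3 ≤ (T₁⁻¹) ^ 3 := pow_le_pow_left₀ hv0.le hvT 3
  have hA : |7 * t - P| ≤ 7 * (P + t) := by
    rw [abs_le]; constructor <;> nlinarith
  have hR : |13 * t - P| ≤ 13 * (P + t) := by
    rw [abs_le]; constructor <;> nlinarith
  have hA' : v ^ 5 * (7 * t - P) ≤ 7 * v₁ ^ 4 := by
    calc v ^ 5 * (7 * t - P) ≤ v ^ 5 * |7 * t - P| :=
          mul_le_mul_of_nonneg_left (le_abs_self _) (by positivity)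
      _ ≤ v ^ 5 * (7 * (P + t)) := mul_le_mul_of_nonneg_left hA (by positivity)
      _ = 7 * v ^ 4 * (v * (P + t)) := by ring
      _ = 7 * v ^ 4 := by rw [hvq, mul_one]
      _ ≤ 7 * v₁ ^ 4 := by linarith
  have hR' : -(29 / 20 * 13 * (T₁⁻¹) ^ 3 * v₁ ^ 4) ≤ b * v ^ 8 * (13 * t - P) := by
    have h1 : b * v ^ 8 * |13 * t - P| ≤ 29 / 20 * 13 * (T₁⁻¹) ^ 3 * v₁ ^ 4 := by
      calc b * v ^ 8 * |13 * t - P| ≤ b * v ^ 8 * (13 * (P + t)) :=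
            mul_le_mul_of_nonneg_left hR (by positivity)
        _ = 13 * b * (v ^ 4 * v ^ 3) * (v * (P + t)) := by ring
        _ = 13 * b * (v ^ 4 * v ^ 3) := by rw [hvq, mul_one]
        _ ≤ 13 * (29 / 20) * (v₁ ^ 4 * (T₁⁻¹) ^ 3) := by
            apply mul_le_mul (by linarith) (mul_le_mul h4 h3 (by positivity) (by positivity))
              (by positivity) (by positivity)
        _ = 29 / 20 * 13 * (T₁⁻¹) ^ 3 * v₁ ^ 4 := by ring
    have h2 : -(b * v ^ 8 * |13 * t - P|) ≤ b * v ^ 8 * (13 * t - P) := by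
      have := neg_abs_le (13 * t - P)
      have hbv : 0 ≤ b * v ^ 8 := by positivity
      nlinarith
    linarith
  have hv14 : 0 ≤ v₁ ^ 4 := by positivity
  have hC' := mul_le_mul_of_nonneg_right hC hv14
  linarith

/-! ## The three nearest offset sites -/

/-- Derivative of `t ↦ (c + t)⁻¹`. [folklore] -/
theorem cvx_hasDerivAt_inv_lin (c t : ℝ) (h : c + t ≠ 0) :
    HasDerivAt (fun t => (c + t)⁻¹) (-((c + t)⁻¹) ^ 2) t := by
  have h1 : HasDerivAt (fun t => c + t) 1 t := by
    simpa using (hasDerivAt_id t).const_add c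
  exact (h1.inv h).congr_deriv (by rw [inv_pow, neg_div, one_div])

/-- **Derivative of the nearest-site curvature** `g(t) = (13t - 1/3)(1/3+t)⁻⁸ - (7t - 1/3)(1/3+t)⁻⁵`:
`g'(t) = (1/3+t)⁻⁹ (7 - 91t) + (1/3+t)⁻⁶ (28t - 4)`. [folklore] -/
theorem cvx_near_hasDerivAt (t : ℝ) (ht : 0 < 1 / 3 + t) :
    HasDerivAt (fun t => (13 * t - 1 / 3) * ((1 / 3 + t)⁻¹) ^ 8 -
        (7 * t - 1 / 3) * ((1 / 3 + t)⁻¹) ^ 5)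
      (((1 / 3 + t)⁻¹) ^ 9 * (7 - 91 * t) + ((1 / 3 + t)⁻¹) ^ 6 * (28 * t - 4)) t := by
  have hv := cvx_hasDerivAt_inv_lin (1 / 3) t ht.ne'
  have hl13 : HasDerivAt (fun t : ℝ => 13 * t - 1 / 3) 13 t := by
    simpa using ((hasDerivAt_id t).const_mul 13).sub_const (1 / 3)
  have hl7 : HasDerivAt (fun t : ℝ => 7 * t - 1 / 3) 7 t := by
    simpa using ((hasDerivAt_id t).const_mul 7).sub_const (1 / 3)
  refine ((hl13.mul (hv.fun_pow 8)).sub (hl7.mul (hv.fun_pow 5))).congr_deriv ?_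
  simp only [Nat.cast_ofNat, show (8 - 1 : ℕ) = 7 from rfl, show (5 - 1 : ℕ) = 4 from rfl]
  have hne : (1 / 3 + t) ≠ 0 := ht.ne'
  field_simp
  ring

/-- **The nearest-site curvature is at least `113/50`** on `t ∈ [0.78², 0.85²]`:
`(13t - 1/3)(1/3+t)⁻⁸ - (7t - 1/3)(1/3+t)⁻⁵ ≥ 113/50` (it is decreasing in `t`; the value at
`t = 0.85²` is `2.2653…`). [folklore] -/
theorem cvx_near_lower (t : ℝ) (ht1 : 1521 / 2500 ≤ t) (ht2 : t ≤ 289 / 400) :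
    113 / 50 ≤ (13 * t - 1 / 3) * ((1 / 3 + t)⁻¹) ^ 8 - (7 * t - 1 / 3) * ((1 / 3 + t)⁻¹) ^ 5 := by
  set g : ℝ → ℝ := fun t => (13 * t - 1 / 3) * ((1 / 3 + t)⁻¹) ^ 8 -
    (7 * t - 1 / 3) * ((1 / 3 + t)⁻¹) ^ 5 with hg
  have hanti : AntitoneOn g (Set.Icc (1521 / 2500) (289 / 400)) := by
    apply antitoneOn_of_hasDerivWithinAt_nonpos (convex_Icc _ _)
      (f' := fun t => ((1 / 3 + t)⁻¹) ^ 9 * (7 - 91 * t) + ((1 / 3 + t)⁻¹) ^ 6 * (28 * t - 4))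
    · intro x hx
      exact (cvx_near_hasDerivAt x (by linarith [hx.1])).continuousAt.continuousWithinAt
    · intro x hx
      rw [interior_Icc] at hx
      exact (cvx_near_hasDerivAt x (by linarith [hx.1])).hasDerivWithinAt
    · intro x hx
      rw [interior_Icc] at hx
      obtain ⟨hx1, hx2⟩ := hx
      have hxpos : 0 < 1 / 3 + x := by linarith
      set v := (1 / 3 + x)⁻¹ with hv
      have hvlo : (1 / 3 + 289 / 400 : ℝ)⁻¹ ≤ v := by
        rw [hv]; exact inv_anti₀ hxpos (by linarith)
      have hc : (1200 / 1267 : ℝ) ≤ v := by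
        have e : (1 / 3 + 289 / 400 : ℝ)⁻¹ = 1200 / 1267 := by norm_num
        linarith [e ▸ hvlo]
      have hv0 : 0 ≤ v := by rw [hv]; positivity
      have h3 : (1200 / 1267 : ℝ) ^ 3 ≤ v ^ 3 := pow_le_pow_left₀ (by norm_num) hc 3
      have hpos : (0 : ℝ) ≤ 91 * x - 7 := by linarith
      have hkey : 28 * x - 4 ≤ v ^ 3 * (91 * x - 7) := by
        nlinarith [mul_le_mul_of_nonneg_right h3 hpos]
      have h6 : 0 ≤ v ^ 6 := by positivity
      have e : v ^ 9 * (7 - 91 * x) + v ^ 6 * (28 * x - 4) =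
          v ^ 6 * ((28 * x - 4) - v ^ 3 * (91 * x - 7)) := by ring
      show v ^ 9 * (7 - 91 * x) + v ^ 6 * (28 * x - 4) ≤ 0
      rw [e]
      exact mul_nonpos_of_nonneg_of_nonpos h6 (by linarith)
  have hmem : t ∈ Set.Icc (1521 / 2500 : ℝ) (289 / 400) := ⟨ht1, ht2⟩
  have hend : (289 / 400 : ℝ) ∈ Set.Icc (1521 / 2500 : ℝ) (289 / 400) := ⟨by norm_num, le_rfl⟩
  have h1 : g (289 / 400) ≤ g t := hanti hmem hend ht2
  have h2 : (113 / 50 : ℝ) ≤ g (289 / 400) := by rw [hg]; norm_num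
  calc (113 / 50 : ℝ) ≤ g (289 / 400) := h2
    _ ≤ g t := h1
    _ = _ := by rw [hg]

/-- **Near-site bound.** At the three nearest offset sites (`P = 1/3`), for `t ∈ [0.78², 0.85²]`
and `b ≥ 1`: `b v⁸ (13t - 1/3) - v⁵ (7t - 1/3) ≥ 113/50` (`v = (1/3 + t)⁻¹`). [folklore] -/
theorem cvx_site_near (t b : ℝ) (ht1 : 1521 / 2500 ≤ t) (ht2 : t ≤ 289 / 400) (hb : 1 ≤ b) :
    (113 / 50 : ℝ) ≤
      b * ((1 / 3 + t)⁻¹) ^ 8 * (13 * t - 1 / 3) - ((1 / 3 + t)⁻¹) ^ 5 * (7 * t - 1 / 3) := by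
  have hg := cvx_near_lower t ht1 ht2
  have hpos : 0 ≤ ((1 / 3 + t)⁻¹) ^ 8 * (13 * t - 1 / 3) := by
    apply mul_nonneg (by positivity); linarith
  nlinarith [mul_le_mul_of_nonneg_right hb hpos]

end Summit.AtomisticToContinuum.Crystallization.Theorems.LayeredHull

end
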